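import Literature.Analysis.FluidPDE.PlanarGateTemplate
import Literature.Analysis.FluidPDE.PlanarSimilarity
import Literature.Analysis.FluidPDE.QuasiSelfSimilarChannelProfile
import HarnessLib

/-!
# Assembly of the two generating moves from checked slot lists: `acm_compatible_blocks` from rational tests

Topic `Literature/Analysis/FluidPDE`. Level-4 data model, part 9 and last (after
`PlanarGateTemplate.lean`, `PlanarSimilarity.lean`; consumer end `QuasiSelfSimilarGeneratorMoves.lean`,
`QuasiSelfSimilarChannelProfile.lean`). The kinematic leaf `acm_compatible_blocks`
(`QuasiSelfSimilarCompatibleBlocks.lean`: the compatible block system of the Peano snake of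
Alberti–Crippa–Mazzucato 2019, §8, given there by figures only) was reduced by
`acm_compatible_blocks_of_generator_moves_peano` to: a straight generator BLOCK, a bent generator
MOVE, an equivariant gate field, and the `2 × 25` cell identities at `t = 1`. This file closes the
generic part of that programme: it turns LISTS OF EMITTED PHASES (`PhaseQ`, `PlanarTypedChain.lean`)
passing finitely many Boolean tests on their rational data into exactly those hypotheses.

* **The package of a checked phase** (`PhaseQ.isGeneratorMoveOn_of_checks`): a phase passing
  `geomB`, `boxSepB`, `agreeB` (`PlanarChainCover.lean`, `PlanarJunctionAgreement.lean`) and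
  `gateOKB` (`PlanarGateTemplate.lean`) with an even smooth profile bounded by `10` and supported in
  `(-r₀, r₀)` IS a generator move (`IsGeneratorMoveOn`) on the times `[a, ∞)` for the gates of its
  stub table and the template gate fields.
* **Time enters through the clock** (`PhaseQ.scalar_congr_clock`, `scalar_of_le/ge`,
  `velocity_of_lt/gt`; `GateC.ΘgT_congr_clock`, `VgT_of_lt/gt`): before / after its clock window a
  phase is static, and so is the gate template outside the squeeze window.
* **Slots** (`Slot`: a phase, its slot start `a`, its stub table, its two re-description
  certificates towards the next phase) and the tests `Slot.okB` (the four checks of the phase —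
  `geomB`, `boxSepB`, `agreeB`, `gateOKB` — the common profile radius, the gate table), `Slot.linkB`
  (re-description certificate `redescribeB` at the frozen instants, glue time strictly inside both
  flat clock windows), `slotsOKB`, `endsOKB` (head slot at `t ≤ 0` with clock after `0`, glue times
  `< 1`, last clock saturating before `1`).
* **Gluing** (`gluedV`, `gluedΘ` by `timeGlue` at the slot starts; `isGeneratorMoveOn_glued` by
  induction with `IsGeneratorMoveOn.glue` and `PhaseQ.fields_eq_of_redescribeB`;
  `isGeneratorMove_glued` by the static extension `IsGeneratorMoveOn.toMove_of_static`; the values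
  `gluedΘ_zero`, `gluedΘ_one`).
* **The uniform start of the straight channel** (`uniRun`, `PhaseQ.uniformB`,
  `PhaseQ.scalar_of_uniformB`: every node element frozen at clock `0` equivalent to the canonical
  uniform run and the tube rectangles chain-covering the band rectangle give
  `Θ(0, z) = G((z₁ - 1/2)/W₀)` on the closed square), whence the two normalisations by
  `moments_of_channelProfile` for the profile `G = channelProfile r` (`1/100 ≤ r ≤ 1/2`).
* **The self-similarity clause on a cell** (`PhaseQ.selfSimilar_cell`) from a similar
  re-description certificate through the child placement (`PlanarSimilarity.lean`).
* **The theorem** `acm_compatible_blocks_of_slots`: a gate template datum with its global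
  conditions, a radius `r ∈ [1/100, 1/2]`, a decidable snake table with a bent child in the
  straight channel, for each generator a slot list passing `slotsOKB` for its gates and `endsOKB`,
  the uniform start of the straight channel, and `2 × 25` similar re-description certificates imply
  `acm_compatible_blocks` (`…_peano`: with the shipped table). Every hypothesis is a Boolean test on
  rational data (to be discharged by `decide +kernel` on emitted designs).

Folklore (bookkeeping); no named facts. With this file the discharge of `acm_compatible_blocks`
is reduced to DATA: the emitted phases of the two moves and their certificates.

## How emitted designs use this file (the data contract)

Per phase `i` of a move: `def Pᵢ : PhaseQ` (clock `[t₀ᵢ, t₀ᵢ + τᵢ]` inside its slot, `r₀ = r` common),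
a stub table `stubᵢ : Fin 2 → Bool → Option ℕ` (node index of the stub at each gate face of the
generator), chunk theorems `∀ k, a ≤ k → k < b → Pᵢ.geomAtB k = true` (and `validB`, the positivity
summand, `sepRowB`, `agreeAtB`) by `decide +kernel` on `≤ 40` nodes each, assembled by
`forall_lt_of_chunk` and the `…_of_…` constructors into `geomB/boxSepB/agreeB = true`;
`Pᵢ.gateOKB C stubᵢ aᵢ = true` by `decide +kernel`; `def slotᵢ : Slot := ⟨Pᵢ, aᵢ, stubᵢ, rcᵢ, rcᵢ'⟩`
and `slotᵢ.okB C (genGate g) r = true` by `Slot.okB_intro`. Per boundary: the two cover certificates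
`rcᵢ, rcᵢ'` (data), chunked `coverEntryB` theorems, `redescribeB … = true` by
`PhaseQ.redescribeB_of_forall`, `Slot.linkB slotᵢ slotᵢ₊₁ = true` by `Slot.linkB_intro`. Per move:
`def L : List Slot := [slot₀, …]`, `slotsOKB … L = true` by `simp only [L, slotsOKB, slot₀_okB, …,
link₀, …, Bool.and_self]`, `endsOKB L = true` and `(headP L_S).uniformB 1 = true` by
`decide +kernel`. Per generator and cell: the two similar cover certificates (data), chunked
`simEntryB` theorems and `simRedescribeB … = true` by `PhaseQ.simRedescribeB_of_forall`; the `50`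
cell statements are fed to `acm_compatible_blocks_of_slots` through `forall_cell_of_forall_fin`.
All these patterns were validated in the kernel on real emitted phases (up to `145` nodes) by the
author; the designs themselves are the business of the design files.

## References

* G. Alberti, G. Crippa, A. L. Mazzucato, *Exponential self-similar mixing by incompressible
  flows*, J. Amer. Math. Soc. 32 (2019), 445–490, §6.5, §8.1 (e), §8.4, §8.6, §8.9–8.11
  (arXiv:1605.02090).
* E. Bruè, C. De Lellis, *Anomalous dissipation for the forced 3D Navier–Stokes equations*,
  Comm. Math. Phys. 400 (2023), 1507–1533, §4.1.
-/

noncomputable section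

open Function Set Filter MeasureTheory
open scoped Topology ContDiff

namespace Literature.Analysis.FluidPDE

namespace PlanarKinematics

open Gluing QuasiSelfSimilar FunctionSpaces FunctionSpaces.Torus

/-- The plane `ℝ²` as a Euclidean space. [folklore] -/
local notation "E²" => EuclideanSpace ℝ (Fin 2)

/-! ## Dependence on time through the clock only -/

namespace PhaseQ

variable (P : PhaseQ)

/-- The out-steps at two times with the same clock value agree. [folklore] -/
theorem sigmaOut_congr_clock {t t' : ℝ} (h : clock P.T0 P.Tau t = clock P.T0 P.Tau t') (k : ℕ) (z : E²) :
    (P.chain.frozen t).sigmaOut k t z = (P.chain.frozen t').sigmaOut k t' z := by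
  simp only [ChainData.sigmaOut, MovingChain.frozen_K, MovingChain.frozen_J, chain_K, chain_J, JStep.val, StepQ.toJ_arg, h]

/-- The in-steps at two times with the same clock value agree. [folklore] -/
theorem sigmaIn_congr_clock {t t' : ℝ} (h : clock P.T0 P.Tau t = clock P.T0 P.Tau t') (k : ℕ) (z : E²) :
    (P.chain.frozen t).sigmaIn k t z = (P.chain.frozen t').sigmaIn k t' z := by
  simp only [ChainData.sigmaIn, P.sigmaOut_congr_clock h]

/-- The cut-offs at two times with the same clock value agree. [folklore] -/
theorem chi_congr_clock {t t' : ℝ} (h : clock P.T0 P.Tau t = clock P.T0 P.Tau t') (k : ℕ) (z : E²) :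
    P.chain.chi k t z = P.chain.chi k t' z := by
  rw [MovingChain.chi_apply, MovingChain.chi_apply, ChainData.chi_apply, ChainData.chi_apply, MovingChain.frozen_B,
    MovingChain.frozen_B, chain_box, BoxQ.moving_frz, BoxQ.moving_frz, h, P.sigmaIn_congr_clock h, P.sigmaOut_congr_clock h]

/-- The element scalars at two times with the same clock value agree. [folklore] -/
theorem Θ_congr_clock (G : ℝ → ℝ) {t t' : ℝ} (h : clock P.T0 P.Tau t = clock P.T0 P.Tau t') (k : ℕ) (z : E²) :
    P.Θ G k t z = P.Θ G k t' z := by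
  simp only [PhaseQ.Θ, ElemQ.scalar_frame, h]

/-- **The assembled scalar depends on time only through the clock.** [folklore] -/
theorem scalar_congr_clock (G : ℝ → ℝ) {t t' : ℝ} (h : clock P.T0 P.Tau t = clock P.T0 P.Tau t') :
    P.scalar G t = P.scalar G t' := by
  funext z
  rw [PhaseQ.scalar, assembledScalar_apply, assembledScalar_apply]
  exact Finset.sum_congr rfl fun k _ => by rw [P.chi_congr_clock h, P.Θ_congr_clock G h]

/-- The assembled scalar before the clock window is the scalar at the window start. [folklore] -/
theorem scalar_of_le (G : ℝ → ℝ) (hτ : 0 < P.τ) {t : ℝ} (ht : t ≤ (P.t₀ : ℝ) + P.τ / 3) :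
    P.scalar G t = P.scalar G P.t₀ := by
  have hτ' : (0 : ℝ) < P.τ := by exact_mod_cast hτ
  apply P.scalar_congr_clock
  rw [show P.T0 = (P.t₀ : ℝ) from rfl, show P.Tau = (P.τ : ℝ) from rfl, clock_of_le hτ' ht, clock_start hτ']

/-- The assembled scalar after the clock window is the scalar at the window end. [folklore] -/
theorem scalar_of_ge (G : ℝ → ℝ) (hτ : 0 < P.τ) {t : ℝ} (ht : (P.t₀ : ℝ) + 2 * P.τ / 3 ≤ t) :
    P.scalar G t = P.scalar G (P.t₀ + P.τ) := by
  have hτ' : (0 : ℝ) < P.τ := by exact_mod_cast hτ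
  apply P.scalar_congr_clock
  rw [show P.T0 = (P.t₀ : ℝ) from rfl, show P.Tau = (P.τ : ℝ) from rfl, clock_of_ge hτ' ht, clock_end hτ']

/-- The assembled velocity vanishes before the clock window. [folklore] -/
theorem velocity_of_lt (hτ : 0 < P.τ) {t : ℝ} (ht : t < (P.t₀ : ℝ) + P.τ / 3) : P.velocity t = 0 := by
  have hτ' : (0 : ℝ) < P.τ := by exact_mod_cast hτ
  funext z
  exact P.velocity_eq_zero_of_clockDeriv (clockDeriv_of_lt hτ' ht) z

/-- The assembled velocity vanishes after the clock window. [folklore] -/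
theorem velocity_of_gt (hτ : 0 < P.τ) {t : ℝ} (ht : (P.t₀ : ℝ) + 2 * P.τ / 3 < t) : P.velocity t = 0 := by
  have hτ' : (0 : ℝ) < P.τ := by exact_mod_cast hτ
  funext z
  exact P.velocity_eq_zero_of_clockDeriv (clockDeriv_of_gt hτ' ht) z

/-- Positivity of the clock length from the geometric check. [folklore] -/
theorem τ_pos_of_geomB (hg : P.geomB = true) : 0 < P.τ := by
  have hv := elemsValidB_of_geomB hg
  simp only [elemsValidB, Bool.and_eq_true, decide_eq_true_eq] at hv
  exact hv.2

end PhaseQ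

namespace GateC

variable {C : GateC}

/-- The template scalar depends on time only through the squeeze clock. [folklore] -/
theorem ΘgT_congr_clock (G : ℝ → ℝ) (k : Fin 2) {t t' : ℝ} (h : clock C.t₀ C.τ t = clock C.t₀ C.τ t') :
    C.ΘgT G k t = C.ΘgT G k t' := by
  funext ζ; fin_cases k <;> simp [Wt, h]

/-- The template velocity vanishes where the rate vanishes. [folklore] -/
theorem VgT_eq_zero_of_rt (k : Fin 2) {t : ℝ} (h : C.rt t = 0) : C.VgT k t = 0 := by
  funext ζ; fin_cases k <;> simp [h, vec2_eq_zero_iff]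

/-- Before the squeeze window the template velocity vanishes. [folklore] -/
theorem VgT_of_lt (hC : C.validB = true) (k : Fin 2) {t : ℝ} (ht : t < (C.t₀ : ℝ) + C.τ / 3) : C.VgT k t = 0 :=
  VgT_eq_zero_of_rt k (by rw [rt, clockDeriv_of_lt (τ_pos hC) ht, zero_mul, zero_div])

/-- After the squeeze window the template velocity vanishes. [folklore] -/
theorem VgT_of_gt (hC : C.validB = true) (k : Fin 2) {t : ℝ} (ht : (C.t₀ : ℝ) + 2 * C.τ / 3 < t) : C.VgT k t = 0 :=
  VgT_eq_zero_of_rt k (rt_of_gt hC ht)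

end GateC

/-! ## The generator-move package of a checked phase (interior facts + gate facts) -/

namespace PhaseQ

variable {P : PhaseQ} {C : GateC} {stub : Fin 2 → Bool → Option ℕ} {a : ℚ}

/-- **A checked phase is a generator move on its slot**: a phase passing the geometric check, the
separation check, the junction check and the gate check, with an even smooth profile bounded by
`10` and supported in `(-r₀, r₀)`, satisfies `IsGeneratorMoveOn` on `[a, ∞)` for the gates of the
stub table and the template gate fields, on all times `t ≥ a`. [folklore] -/
theorem isGeneratorMoveOn_of_checks {G : ℝ → ℝ} (hG : ContDiff ℝ ∞ G) (hM : ∀ q, |G q| ≤ 10)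
    (hG0 : ∀ q, G q ≠ 0 → |q| < P.r₀) (hGe : ∀ x, G (-x) = G x)
    (hg : P.geomB = true) (hsep : P.boxSepB = true) (ha : P.agreeB = true) (hgate : P.gateOKB C stub a = true) :
    IsGeneratorMoveOn (Ici (a : ℝ)) P.velocity (P.scalar G) (gateOf stub) C.VgT (C.ΘgT G) C.δ := by
  have hv := elemsValidB_of_geomB hg
  have hw := wfbd_of_geomB hg hsep
  have h10 : (0 : ℝ) ≤ 10 := by norm_num
  have hsq : ∀ z : E², z ∈ closedSquare → ∀ j, 0 ≤ z j ∧ z j ≤ 1 := fun z hz j => hz j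
  exact
    { smooth_velocity := P.contDiff_uncurry_velocity hG hM h10 hG0 hv hw
      smooth_scalar := P.contDiff_uncurry_scalar hG hM h10 hG0 hv hw
      divFree := fun t _ z _ => P.divergence_velocity hG hM h10 hG0 hv hw t z
      tangent := fun t ht z _ j hj => tangent_of_gateOKB hw hv hgate ht z j hj
      transport := fun t _ z hz => transport_of_checks hG hM h10 hG0 hGe hg hsep ha t (hsq z hz)
      abs_le := fun t _ z hz => abs_scalar_le_of_checks hG hM h10 hG0 hGe hg hsep ha t (hsq z hz)
      vanish := fun t _ z k s hz hws => vanish_of_gateOKB hw hgate G t hz hws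
      eq_gate := fun t ht z k s hgs hz hzw => by
        obtain ⟨n, hst⟩ := Option.isSome_iff_exists.1 hgs
        have hzw' : |z (GateC.oth k) - 1 / 2| < 2 * C.δ := by simpa [one_div] using hzw (GateC.oth k) (GateC.oth_ne k)
        have e := eq_gate_of_gateOKB hw hv hgate G ht hst hz hzw'
        exact ⟨e.2, e.1⟩ }

end PhaseQ

/-! ## Slots: phases with their slot start, stub table and re-description certificates -/

/-- **A slot** of a generating move: the phase, the start `a` of its time slot (the glue time with
the previous phase), its stub table, and the re-description certificates towards the NEXT phase
(this phase frozen at clock `1`, the next at clock `0`). [folklore] -/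
structure Slot where
  /-- the phase -/
  P : PhaseQ
  /-- slot start -/
  a : ℚ
  /-- stub table -/
  stub : Fin 2 → Bool → Option ℕ
  /-- cover certificate of this phase's end keyframe by the next phase's start keyframe -/
  rc : List (Fin 2 × List (ℕ × EquivCert))
  /-- cover certificate of the next phase's start keyframe by this phase's end keyframe -/
  rc' : List (Fin 2 × List (ℕ × EquivCert))

namespace Slot

/-- **Slot test**: the phase passes its four checks on its slot, has the common profile radius,
and its stub table realises the gate table. [folklore] -/
def okB (s : Slot) (C : GateC) (gate : Fin 2 → Bool → Bool) (r : ℚ) : Bool :=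
  s.P.geomB && s.P.boxSepB && s.P.agreeB && s.P.gateOKB C s.stub s.a && decide (s.P.r₀ = r) &&
    decide (∀ k sd, PhaseQ.gateOf s.stub k sd = gate k sd)

/-- **Link test** between consecutive slots: the re-description certificate, and the glue time
strictly inside the flat windows of both clocks. [folklore] -/
def linkB (s s' : Slot) : Bool :=
  PhaseQ.redescribeB s.P true s'.P false s.rc s.rc' && decide (s.P.t₀ + 2 * s.P.τ / 3 < s'.a) &&
    decide (s'.a < s'.P.t₀ + s'.P.τ / 3) && decide (s.a ≤ s'.a)

end Slot

/-- **Slot list test.** [folklore] -/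
def slotsOKB (C : GateC) (gate : Fin 2 → Bool → Bool) (r : ℚ) : List Slot → Bool
  | [] => false
  | [s] => s.okB C gate r
  | s :: s' :: rest => s.okB C gate r && Slot.linkB s s' && slotsOKB C gate r (s' :: rest)

/-- **The glued velocity of a slot list.** [folklore] -/
def gluedV : List Slot → ℝ → E² → E²
  | [] => fun _ _ => 0
  | [s] => s.P.velocity
  | s :: s' :: rest => timeGlue (s'.a : ℝ) s.P.velocity (gluedV (s' :: rest))

/-- **The glued scalar of a slot list** (profile `G`). [folklore] -/
def gluedΘ (G : ℝ → ℝ) : List Slot → ℝ → E² → ℝ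
  | [] => fun _ _ => 0
  | [s] => s.P.scalar G
  | s :: s' :: rest => timeGlue (s'.a : ℝ) (s.P.scalar G) (gluedΘ G (s' :: rest))

/-- The slot start of the head. [folklore] -/
def headA : List Slot → ℚ
  | [] => 0
  | s :: _ => s.a

/-- The phase of the head. [folklore] -/
def headP : List Slot → PhaseQ
  | [] => default
  | s :: _ => s.P

/-- The phase of the last slot. [folklore] -/
def lastP : List Slot → PhaseQ
  | [] => default
  | [s] => s.P
  | _ :: s' :: rest => lastP (s' :: rest)

/-- **Bundled profile facts** used by all phases: smooth, even, bounded by `10`, support radius `r`. [folklore] -/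
structure ProfileOK (G : ℝ → ℝ) (r : ℚ) : Prop where
  /-- smooth -/
  smooth : ContDiff ℝ ∞ G
  /-- bounded by `10` -/
  bound : ∀ q, |G q| ≤ 10
  /-- support radius -/
  supp : ∀ q, G q ≠ 0 → |q| < r
  /-- even -/
  even : ∀ q, G (-q) = G q

namespace ProfileOK

variable {G : ℝ → ℝ} {r : ℚ}

/-- The profile hypotheses of the re-description theorem for a phase with radius `r`. [folklore] -/
theorem hyp (h : ProfileOK G r) {P : PhaseQ} (hr : P.r₀ = r) : PhaseQ.ProfileHyp G 10 P.r₀ :=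
  ⟨h.smooth, h.bound, by norm_num, by rw [hr]; exact h.supp, h.even⟩

end ProfileOK

section Glue

variable {C : GateC} {gate : Fin 2 → Bool → Bool} {r : ℚ} {G : ℝ → ℝ}

/-- Unpacking the slot test. [folklore] -/
theorem Slot.okB_iff (s : Slot) : s.okB C gate r = true ↔
    s.P.geomB = true ∧ s.P.boxSepB = true ∧ s.P.agreeB = true ∧ s.P.gateOKB C s.stub s.a = true ∧ s.P.r₀ = r ∧
      PhaseQ.gateOf s.stub = gate := by
  simp only [Slot.okB, Bool.and_eq_true, decide_eq_true_eq, and_assoc]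
  constructor
  · rintro ⟨h1, h2, h3, h4, h5, h6⟩; exact ⟨h1, h2, h3, h4, h5, funext fun k => funext fun sd => h6 k sd⟩
  · rintro ⟨h1, h2, h3, h4, h5, h6⟩; exact ⟨h1, h2, h3, h4, h5, fun k sd => by rw [h6]⟩


/-- **Constructor of the slot test** from its six parts. [folklore] -/
theorem Slot.okB_intro {s : Slot} (hg : s.P.geomB = true) (hsep : s.P.boxSepB = true) (ha : s.P.agreeB = true)
    (hgate : s.P.gateOKB C s.stub s.a = true) (hr : s.P.r₀ = r) (hgt : ∀ k sd, PhaseQ.gateOf s.stub k sd = gate k sd) :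
    s.okB C gate r = true :=
  s.okB_iff.2 ⟨hg, hsep, ha, hgate, hr, funext fun k => funext fun sd => hgt k sd⟩

/-- **Constructor of the link test** from its four parts. [folklore] -/
theorem Slot.linkB_intro {s s' : Slot} (hred : PhaseQ.redescribeB s.P true s'.P false s.rc s.rc' = true)
    (h1 : s.P.t₀ + 2 * s.P.τ / 3 < s'.a) (h2 : s'.a < s'.P.t₀ + s'.P.τ / 3) (h3 : s.a ≤ s'.a) : Slot.linkB s s' = true := by
  simp only [Slot.linkB, hred, h1, h2, h3, decide_true, Bool.and_self]

/-- **A single checked slot is a generator move on `[a, ∞)`.** [folklore] -/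
theorem Slot.isGeneratorMoveOn (hG : ProfileOK G r) {s : Slot} (h : s.okB C gate r = true) :
    IsGeneratorMoveOn (Ici (s.a : ℝ)) s.P.velocity (s.P.scalar G) gate C.VgT (C.ΘgT G) C.δ := by
  obtain ⟨hg, hsep, ha, hgate, hr, hgt⟩ := s.okB_iff.1 h
  rw [← hgt]
  exact PhaseQ.isGeneratorMoveOn_of_checks hG.smooth hG.bound (by rw [hr]; exact hG.supp) hG.even hg hsep ha hgate

/-- The head of a checked slot list passes the slot test. [folklore] -/
theorem okB_head_of_slotsOKB {s : Slot} {rest : List Slot} (h : slotsOKB C gate r (s :: rest) = true) :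
    s.okB C gate r = true := by
  cases rest with
  | nil => exact h
  | cons s' rest => simp only [slotsOKB, Bool.and_eq_true] at h; exact h.1.1

/-- **The glued fields of a checked list are those of the head before the head's clock saturates.** [folklore] -/
theorem glued_eq_head {s : Slot} {rest : List Slot} (h : slotsOKB C gate r (s :: rest) = true) {t : ℝ}
    (ht : t ≤ (s.P.t₀ : ℝ) + 2 * s.P.τ / 3) :
    gluedV (s :: rest) t = s.P.velocity t ∧ gluedΘ G (s :: rest) t = s.P.scalar G t := by
  cases rest with
  | nil => exact ⟨rfl, rfl⟩
  | cons s' rest =>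
    simp only [slotsOKB, Bool.and_eq_true, Slot.linkB, decide_eq_true_eq] at h
    obtain ⟨⟨-, ⟨⟨-, h1⟩, -⟩, -⟩, -⟩ := h
    have h1' : (s.P.t₀ : ℝ) + 2 * s.P.τ / 3 < s'.a := by exact_mod_cast h1
    exact ⟨timeGlue_of_le _ _ (by linarith), timeGlue_of_le _ _ (by linarith)⟩

/-- **Gluing a checked slot list**: a generator move on `[a_head, ∞)`. [folklore] -/
theorem isGeneratorMoveOn_glued (hG : ProfileOK G r) :
    ∀ (L : List Slot), slotsOKB C gate r L = true →
      IsGeneratorMoveOn (Ici (headA L : ℝ)) (gluedV L) (gluedΘ G L) gate C.VgT (C.ΘgT G) C.δ := by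
  intro L
  induction L with
  | nil => intro h; exact absurd h (by simp [slotsOKB])
  | cons s rest ih =>
    cases rest with
    | nil => intro h; exact Slot.isGeneratorMoveOn hG h
    | cons s' rest =>
      intro h
      have hfull := h
      simp only [slotsOKB, Bool.and_eq_true] at h
      obtain ⟨⟨hs, hlink⟩, hrest⟩ := h
      have h₁ := Slot.isGeneratorMoveOn hG hs
      have h₂ := ih hrest
      simp only [headA] at h₂ ⊢
      -- the glue window
      simp only [Slot.linkB, Bool.and_eq_true, decide_eq_true_eq] at hlink
      obtain ⟨⟨⟨hred, hb1⟩, hb2⟩, hab⟩ := hlink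
      obtain ⟨hg, hsep, ha, -, hr, -⟩ := s.okB_iff.1 hs
      obtain ⟨hg', hsep', ha', -, hr', -⟩ := s'.okB_iff.1 (okB_head_of_slotsOKB hrest)
      have hτ := s.P.τ_pos_of_geomB hg
      have hτ' := s'.P.τ_pos_of_geomB hg'
      have hτr : (0 : ℝ) < s.P.τ := by exact_mod_cast hτ
      have hτr' : (0 : ℝ) < s'.P.τ := by exact_mod_cast hτ'
      have hb1' : (s.P.t₀ : ℝ) + 2 * s.P.τ / 3 < s'.a := by exact_mod_cast hb1
      have hb2' : (s'.a : ℝ) < s'.P.t₀ + s'.P.τ / 3 := by exact_mod_cast hb2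
      set ε : ℝ := min ((s'.a : ℝ) - (s.P.t₀ + 2 * s.P.τ / 3)) ((s'.P.t₀ : ℝ) + s'.P.τ / 3 - s'.a) with hε
      have hεpos : 0 < ε := lt_min (by linarith) (by linarith)
      have hwin : ∀ t ∈ Ioo ((s'.a : ℝ) - ε) (s'.a + ε),
          (s.P.t₀ : ℝ) + 2 * s.P.τ / 3 < t ∧ t < (s'.P.t₀ : ℝ) + s'.P.τ / 3 := fun t ht => by
        have e1 : ε ≤ (s'.a : ℝ) - (s.P.t₀ + 2 * s.P.τ / 3) := min_le_left _ _
        have e2 : ε ≤ (s'.P.t₀ : ℝ) + s'.P.τ / 3 - s'.a := min_le_right _ _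
        exact ⟨by linarith [ht.1], by linarith [ht.2]⟩
      -- the two phases agree on the window (re-description at the frozen instants)
      have hv := PhaseQ.elemsValidB_of_geomB hg
      have hv' := PhaseQ.elemsValidB_of_geomB hg'
      have hagree : ∀ t ∈ Ioo ((s'.a : ℝ) - ε) (s'.a + ε),
          s.P.scalar G t = s'.P.scalar G t ∧ s.P.velocity t = s'.P.velocity t := fun t ht => by
        obtain ⟨h1, h2⟩ := hwin t ht
        exact PhaseQ.fields_eq_of_redescribeB (hG.hyp hr) (hG.hyp hr') hg hsep
          (PhaseQ.scalar_juncCut_of_agreeB hG.even ha hv) hg' hsep' (PhaseQ.scalar_juncCut_of_agreeB hG.even ha' hv') hred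
          (by show clock s.P.T0 s.P.Tau t = endVal true; simp only [endVal, if_true]; exact clock_of_ge hτr h1.le)
          (by show clock s'.P.T0 s'.P.Tau t = endVal false; simp only [endVal]; exact clock_of_le hτr' h2.le)
          (clockDeriv_of_gt hτr h1) (clockDeriv_of_lt hτr' h2)
      -- on the window the glued tail is the next phase
      have htail : ∀ t ∈ Ioo ((s'.a : ℝ) - ε) (s'.a + ε),
          gluedV (s' :: rest) t = s'.P.velocity t ∧ gluedΘ G (s' :: rest) t = s'.P.scalar G t := fun t ht =>
        glued_eq_head hrest (by linarith [(hwin t ht).2, hτr'])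
      have hV : ∀ t ∈ Ioo ((s'.a : ℝ) - ε) (s'.a + ε), s.P.velocity t = gluedV (s' :: rest) t := fun t ht => by
        rw [(htail t ht).1, (hagree t ht).2]
      have hΘ : ∀ t ∈ Ioo ((s'.a : ℝ) - ε) (s'.a + ε), s.P.scalar G t = gluedΘ G (s' :: rest) t := fun t ht => by
        rw [(htail t ht).2, (hagree t ht).1]
      have hab' : (s.a : ℝ) ≤ s'.a := by exact_mod_cast hab
      exact (h₁.glue hεpos h₂ hV hΘ).mono fun t (ht : (s.a : ℝ) ≤ t) =>
        ⟨fun _ => ht, fun htb => (le_of_lt htb : (s'.a : ℝ) ≤ t)⟩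

end Glue

/-! ## After the glue times; the static extension; the values at `t = 0` and `t = 1` -/

/-- **All glue times of a slot list are below `c`** (the slot starts of all slots but the head). [folklore] -/
def tailAllLtB (c : ℚ) : List Slot → Bool
  | [] => true
  | _ :: rest => rest.all fun s => decide (s.a < c)

/-- **End conditions of a slot list**: the head slot starts at or before `0` with its clock window
starting at or after `0`, all glue times are below `1`, and the last clock saturates before `1`. [folklore] -/
def endsOKB (L : List Slot) : Bool :=
  decide (headA L ≤ 0) && decide (0 ≤ (headP L).t₀) && tailAllLtB 1 L &&
    decide ((lastP L).t₀ + 2 * (lastP L).τ / 3 < 1)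

section Ends

variable {C : GateC} {gate : Fin 2 → Bool → Bool} {r : ℚ} {G : ℝ → ℝ}

/-- The last slot of a checked list passes the slot test. [folklore] -/
theorem okB_last_of_slotsOKB : ∀ (L : List Slot), slotsOKB C gate r L = true →
    (lastP L).geomB = true ∧ (lastP L).boxSepB = true ∧ (lastP L).agreeB = true ∧ (lastP L).r₀ = r := by
  intro L
  induction L with
  | nil => intro h; exact absurd h (by simp [slotsOKB])
  | cons s rest ih =>
    cases rest with
    | nil =>
      intro h
      obtain ⟨hg, hsep, ha, -, hr, -⟩ := s.okB_iff.1 h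
      exact ⟨hg, hsep, ha, hr⟩
    | cons s' rest =>
      intro h
      simp only [slotsOKB, Bool.and_eq_true] at h
      exact ih h.2

/-- **After all glue times the glued fields are those of the last phase.** [folklore] -/
theorem glued_eq_last {c : ℚ} : ∀ (L : List Slot), L ≠ [] → tailAllLtB c L = true → ∀ t : ℝ, (c : ℝ) ≤ t →
    gluedV L t = (lastP L).velocity t ∧ gluedΘ G L t = (lastP L).scalar G t := by
  intro L
  induction L with
  | nil => intro h; exact absurd rfl h
  | cons s rest ih =>
    cases rest with
    | nil => intro _ _ t _; exact ⟨rfl, rfl⟩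
    | cons s' rest =>
      intro _ h t ht
      simp only [tailAllLtB, List.all_cons, Bool.and_eq_true, decide_eq_true_eq] at h
      have h1 : (s'.a : ℝ) < t := lt_of_lt_of_le (by exact_mod_cast h.1) ht
      have ih' := ih (List.cons_ne_nil _ _) (by simpa [tailAllLtB] using h.2) t ht
      simp only [gluedV, gluedΘ, lastP]
      rw [timeGlue_of_lt _ _ h1, timeGlue_of_lt _ _ h1]
      exact ih'

/-- A checked slot list is nonempty. [folklore] -/
theorem ne_nil_of_slotsOKB {L : List Slot} (h : slotsOKB C gate r L = true) : L ≠ [] := by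
  rintro rfl; simp [slotsOKB] at h

/-- The head phase of a checked slot list passes its checks. [folklore] -/
theorem head_facts_of_slotsOKB {L : List Slot} (h : slotsOKB C gate r L = true) :
    (headP L).geomB = true ∧ (headP L).boxSepB = true ∧ (headP L).agreeB = true ∧ (headP L).r₀ = r := by
  cases L with
  | nil => exact absurd h (by simp [slotsOKB])
  | cons s rest =>
    obtain ⟨hg, hsep, ha, -, hr, -⟩ := s.okB_iff.1 (okB_head_of_slotsOKB h)
    exact ⟨hg, hsep, ha, hr⟩

/-- **The glued fields at times `≤ 0`** are the head's, for a list with end conditions. [folklore] -/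
theorem glued_of_nonpos {L : List Slot} (hL : slotsOKB C gate r L = true) (hE : endsOKB L = true) {t : ℝ} (ht : t ≤ 0) :
    gluedV L t = 0 ∧ gluedΘ G L t = (headP L).scalar G (headP L).t₀ := by
  cases L with
  | nil => exact absurd hL (by simp [slotsOKB])
  | cons s rest =>
    simp only [endsOKB, Bool.and_eq_true, decide_eq_true_eq, headA, headP] at hE
    obtain ⟨⟨⟨-, h0⟩, -⟩, -⟩ := hE
    have hg := (s.okB_iff.1 (okB_head_of_slotsOKB hL)).1
    have hτ := s.P.τ_pos_of_geomB hg
    have hτr : (0 : ℝ) < s.P.τ := by exact_mod_cast hτ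
    have h0' : (0 : ℝ) ≤ s.P.t₀ := by exact_mod_cast h0
    obtain ⟨hV, hΘ⟩ := glued_eq_head (G := G) hL (t := t) (by linarith)
    simp only [headP]
    rw [hV, hΘ, s.P.velocity_of_lt hτ (by linarith), s.P.scalar_of_le G hτ (by linarith)]
    exact ⟨rfl, rfl⟩

/-- **The glued fields at times `≥ 1`** are the last phase's end fields, for a list with end conditions. [folklore] -/
theorem glued_of_one_le {L : List Slot} (hL : slotsOKB C gate r L = true) (hE : endsOKB L = true) {t : ℝ} (ht : 1 ≤ t) :
    gluedV L t = 0 ∧ gluedΘ G L t = (lastP L).scalar G ((lastP L).t₀ + (lastP L).τ) := by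
  simp only [endsOKB, Bool.and_eq_true, decide_eq_true_eq] at hE
  obtain ⟨⟨-, htail⟩, h1⟩ := hE
  have hg := (okB_last_of_slotsOKB L hL).1
  have hτ := (lastP L).τ_pos_of_geomB hg
  have h1' : ((lastP L).t₀ : ℝ) + 2 * (lastP L).τ / 3 < 1 := by exact_mod_cast h1
  obtain ⟨hV, hΘ⟩ := glued_eq_last (G := G) L (ne_nil_of_slotsOKB hL) htail t (by exact_mod_cast ht)
  rw [hV, hΘ, (lastP L).velocity_of_gt hτ (by linarith), (lastP L).scalar_of_ge G hτ (by linarith)]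
  exact ⟨rfl, rfl⟩

/-- **The glued move of a checked slot list with end conditions is a generator move** (static
extension outside `[0, 1]`, `IsGeneratorMoveOn.toMove_of_static`). [folklore] -/
theorem isGeneratorMove_glued (hG : ProfileOK G r) (hC : C.validB = true) (hC0 : 0 ≤ C.t₀) (hC1 : C.t₀ + 2 * C.τ / 3 < 1)
    {L : List Slot} (hL : slotsOKB C gate r L = true) (hE : endsOKB L = true) :
    IsGeneratorMove (gluedV L) (gluedΘ G L) gate C.VgT (C.ΘgT G) C.δ := by
  have hon := isGeneratorMoveOn_glued hG L hL
  have hE' := hE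
  simp only [endsOKB, Bool.and_eq_true, decide_eq_true_eq] at hE'
  obtain ⟨⟨⟨ha, -⟩, -⟩, -⟩ := hE'
  have ha' : (headA L : ℝ) ≤ 0 := by exact_mod_cast ha
  have hτC := GateC.τ_pos hC
  have hC0' : (0 : ℝ) ≤ C.t₀ := by exact_mod_cast hC0
  have hC1' : (C.t₀ : ℝ) + 2 * C.τ / 3 < 1 := by exact_mod_cast hC1
  refine (hon.mono fun t ht => le_trans ha' ht.1).toMove_of_static ?_ ?_ ?_ ?_ ?_ ?_ ?_ ?_
  · intro t ht; rw [(glued_of_nonpos (G := G) hL hE ht).1, (glued_of_nonpos (G := G) hL hE le_rfl).1]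
  · intro t ht; rw [(glued_of_nonpos hL hE ht).2, (glued_of_nonpos hL hE le_rfl).2]
  · intro t ht; rw [(glued_of_one_le (G := G) hL hE ht).1, (glued_of_one_le (G := G) hL hE le_rfl).1]
  · intro t ht; rw [(glued_of_one_le hL hE ht).2, (glued_of_one_le hL hE le_rfl).2]
  · intro k t ht
    rw [GateC.VgT_of_lt hC k (by linarith), GateC.VgT_of_lt hC k (by linarith)]
  · intro k t ht
    exact GateC.ΘgT_congr_clock G k (by rw [clock_of_le hτC (by linarith), clock_of_le hτC (by linarith)])
  · intro k t ht
    rw [GateC.VgT_of_gt hC k (by linarith), GateC.VgT_of_gt hC k hC1']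
  · intro k t ht
    exact GateC.ΘgT_congr_clock G k (by rw [clock_of_ge hτC (by linarith), clock_of_ge hτC hC1'.le])

/-- **The glued scalar at `t = 0`** is the head's scalar at `0`, whose clock is `0`. [folklore] -/
theorem gluedΘ_zero {L : List Slot} (hL : slotsOKB C gate r L = true) (hE : endsOKB L = true) :
    gluedΘ G L 0 = (headP L).scalar G 0 ∧ clock (headP L).T0 (headP L).Tau 0 = 0 := by
  cases L with
  | nil => exact absurd hL (by simp [slotsOKB])
  | cons s rest =>
    simp only [endsOKB, Bool.and_eq_true, decide_eq_true_eq, headA, headP] at hE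
    obtain ⟨⟨⟨-, h0⟩, -⟩, -⟩ := hE
    have hg := (s.okB_iff.1 (okB_head_of_slotsOKB hL)).1
    have hτ := s.P.τ_pos_of_geomB hg
    have hτr : (0 : ℝ) < s.P.τ := by exact_mod_cast hτ
    have h0' : (0 : ℝ) ≤ s.P.t₀ := by exact_mod_cast h0
    refine ⟨(glued_eq_head (G := G) hL (t := 0) (by linarith)).2, ?_⟩
    show clock (s.P.t₀ : ℝ) (s.P.τ : ℝ) 0 = 0
    exact clock_of_le hτr (by linarith)

/-- **The glued scalar at `t = 1`** is the last phase's scalar at `1`, whose clock is `1`. [folklore] -/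
theorem gluedΘ_one {L : List Slot} (hL : slotsOKB C gate r L = true) (hE : endsOKB L = true) :
    gluedΘ G L 1 = (lastP L).scalar G 1 ∧ clock (lastP L).T0 (lastP L).Tau 1 = 1 := by
  have hE' := hE
  simp only [endsOKB, Bool.and_eq_true, decide_eq_true_eq] at hE'
  obtain ⟨⟨-, htail⟩, h1⟩ := hE'
  have hg := (okB_last_of_slotsOKB L hL).1
  have hτ := (lastP L).τ_pos_of_geomB hg
  have hτr : (0 : ℝ) < (lastP L).τ := by exact_mod_cast hτ
  have h1' : ((lastP L).t₀ : ℝ) + 2 * (lastP L).τ / 3 < 1 := by exact_mod_cast h1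
  refine ⟨(glued_eq_last (G := G) L (ne_nil_of_slotsOKB hL) htail 1 (by norm_num)).2, ?_⟩
  show clock ((lastP L).t₀ : ℝ) ((lastP L).τ : ℝ) 1 = 1
  exact clock_of_ge hτr h1'.le

end Ends

/-! ## The uniform start of the straight channel -/

/-- **The canonical uniform run** in the frame `o` with slope `W₀`: the band `y = 1/2` read with
material slope `W₀`. [folklore] -/
def uniRun (o : Fin 8) (W0 : ℚ) : ElemQ :=
  .run ⟨o, Aff.const (1 / 2), ⟨Aff.const 0, Aff.const W0, []⟩, W0, W0, Aff.const 0, Aff.const 0⟩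

/-- **The scalar of the canonical uniform run** in the frames `E` (`0`) and `W` (`2`). [folklore] -/
theorem scalar_uniRun {o : Fin 8} (ho : o = 0 ∨ o = 2) (W0 : ℚ) (t₀ τ : ℝ) (G : ℝ → ℝ) (t : ℝ) (z : E²) :
    (uniRun o W0).scalar t₀ τ G t z = G ((z 1 - 1 / 2) / W0) := by
  have hv : (uniRun o W0).vOf z = z 1 := by
    rcases ho with rfl | rfl <;> simp [uniRun, ElemQ.vOf, ElemQ.vC, d4c, d4d]
  rw [ElemQ.scalar_frame, hv]
  simp [uniRun, ElemQ.line, ElemQ.xi, Pw.du]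

namespace PhaseQ

variable (P : PhaseQ)

/-- **Uniform-start test** (slope `W₀`): step signs `±1`, every node element frozen at clock `0`
equivalent to the canonical uniform run in frame `E` or `W`, and the tube rectangles at clock `0`
chain-covering the band rectangle `[0,1] × [1/2 ∓ r₀ W₀]`. [folklore] -/
def uniformB (W0 : ℚ) : Bool :=
  P.sgnsOKB &&
    ((List.range P.K).all fun k =>
      ElemQ.equivB (P.node k).e false (uniRun 0 W0) false || ElemQ.equivB (P.node k).e false (uniRun 2 W0) false) &&
    (⟨![0, 1 / 2 - P.r₀ * W0], ![1, 1 / 2 + P.r₀ * W0]⟩ : RectQ).chainCoversB 0 ((List.range P.K).map fun k => P.tubeRect k false)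

variable {P}

/-- **The scalar of a uniform start**: a checked phase passing the uniform-start test has, at every
clock-`0` time and on the closed square, the scalar `G((z₁ - 1/2)/W₀)`. [folklore] -/
theorem scalar_of_uniformB {G : ℝ → ℝ} {r W0 : ℚ} (hG : ProfileOK G r) (hg : P.geomB = true) (hsep : P.boxSepB = true)
    (ha : P.agreeB = true) (hr : P.r₀ = r) (hU : P.uniformB W0 = true) (hW0 : 0 < W0)
    {t : ℝ} (ht : clock P.T0 P.Tau t = 0) {z : E²} (hz : ∀ j, 0 ≤ z j ∧ z j ≤ 1) :
    P.scalar G t z = G ((z 1 - 1 / 2) / W0) := by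
  simp only [uniformB, Bool.and_eq_true, List.all_eq_true, List.mem_range, Bool.or_eq_true] at hU
  obtain ⟨⟨hs, hequiv⟩, hcov⟩ := hU
  have hv := elemsValidB_of_geomB hg
  have hA := scalar_juncCut_of_agreeB hG.even ha hv
  have hGP := hG.hyp hr
  have ht' : clock P.T0 P.Tau t = endVal false := by simpa [endVal] using ht
  have h0 : clock (0 : ℝ) 1 0 = endVal false := by simp [endVal, clock_start]
  -- the value of every node element at the point
  have helem : ∀ k < P.K, P.Θ G k t z = G ((z 1 - 1 / 2) / W0) := fun k hk => by
    rcases hequiv k hk with h | h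
    · rw [PhaseQ.Θ, ElemQ.scalar_eq_of_equivB h G ht' h0 z, scalar_uniRun (Or.inl rfl)]
    · rw [PhaseQ.Θ, ElemQ.scalar_eq_of_equivB h G ht' h0 z, scalar_uniRun (Or.inr rfl)]
  by_cases h1 : ∃ k < P.K, (t, z) ∈ P.chain.tubeBox k ∩ P.Band k
  · obtain ⟨k, hk, hp⟩ := h1
    rw [scalar_eq_elem hg hsep hA hk hz hp, helem k hk]
  · push Not at h1
    rw [scalar_eq_zero_off hGP.smooth hGP.bound hGP.nonneg hGP.supp hg hsep h1]
    by_contra hne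
    -- the point lies in the band rectangle, hence in a tube box, and the element is nonzero there
    have hq : |(z 1 - 1 / 2) / (W0 : ℝ)| < r := hG.supp _ (Ne.symm hne)
    have hW0' : (0 : ℝ) < W0 := by exact_mod_cast hW0
    rw [abs_div, abs_of_pos hW0', div_lt_iff₀ hW0'] at hq
    have hzR : (⟨![0, 1 / 2 - P.r₀ * W0], ![1, 1 / 2 + P.r₀ * W0]⟩ : RectQ).mem z := by
      intro i; fin_cases i
      · simp; exact ⟨(hz 0).1, (hz 0).2⟩
      · simp only [Fin.mk_one, Fin.isValue, Matrix.cons_val_one, Matrix.cons_val_fin_one]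
        rw [hr]; push_cast
        rw [abs_lt] at hq
        constructor <;> linarith
    obtain ⟨S, hS, hzS⟩ := RectQ.exists_mem_of_chainCoversB hcov hzR
    obtain ⟨k, hk, rfl⟩ := List.mem_map.1 hS
    rw [List.mem_range] at hk
    have hpos : P.allPosB = true := (geomB_at hg hk).2.1
    have htube : (t, z) ∈ P.chain.tubeBox k := (mem_tubeRect_iff hpos hs hk ht' z).1 hzS
    have hband : (t, z) ∈ P.Band k :=
      (P.facts hGP.smooth hGP.bound hGP.nonneg hGP.supp hv).band k hk (t, z) (by rw [helem k hk]; exact Ne.symm hne)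
    exact h1 k hk ⟨htube, hband⟩

/-- **The self-similarity clause on one cell** from a similar re-description certificate: the scalar
of `P` at a clock-`1` time, on the open cell `p`, is the scalar of `P'` at a clock-`0` time placed
by the code `c` in the cell. [folklore] -/
theorem selfSimilar_cell {G : ℝ → ℝ} {r : ℚ} {P' : PhaseQ} (hG : ProfileOK G r)
    (hg : P.geomB = true) (hsep : P.boxSepB = true) (ha : P.agreeB = true) (hr : P.r₀ = r)
    (hg' : P'.geomB = true) (hsep' : P'.boxSepB = true) (ha' : P'.agreeB = true) (hr' : P'.r₀ = r)
    {c : SymmCode} {p : Fin 2 → Fin 5} {cert cert' : List (Fin 2 × List (ℕ × EquivCert))}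
    (hc : P.simRedescribeB true P' false (Simil.ofChild c p) (Simil.cellRect p) cert cert' = true)
    {t t' : ℝ} (ht : clock P.T0 P.Tau t = 1) (ht' : clock P'.T0 P'.Tau t' = 0)
    {z : E²} (hz : z ∈ latticeCellInterior 5 fun k => ((p k : ℕ) : ℤ)) :
    P.scalar G t z = c.toSymm.actScalar (P'.scalar G) t' ((5 : ℝ) • z - latticeVec fun k => ((p k : ℕ) : ℤ)) := by
  rw [SquareSymm.actScalar_apply, ← Simil.ofChild_app]
  obtain ⟨hQ, hsq, hsq'⟩ := Simil.cell_facts c p hz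
  have hv := elemsValidB_of_geomB hg
  have hv' := elemsValidB_of_geomB hg'
  exact scalar_eq_of_simRedescribeB (hG.hyp hr) (hG.hyp hr') hg hsep (scalar_juncCut_of_agreeB hG.even ha hv) hg' hsep'
    (scalar_juncCut_of_agreeB hG.even ha' hv') hc (by simpa [endVal] using ht) (by simpa [endVal] using ht') hQ hsq hsq'

end PhaseQ

/-! ## Chunked verification: the tests from bounded universal statements

The emitted phases have up to a few hundred nodes; the kernel decides the tests in chunks of nodes
(`∀ k, a ≤ k → k < b → …`, `Nat.decidableLoHi`) and the following constructors assemble them. -/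

section Chunks

/-- **Gluing a chunk** to a bounded universal statement. [folklore] -/
theorem forall_lt_of_chunk {p : ℕ → Prop} {a b : ℕ} (h1 : ∀ k < a, p k) (h2 : ∀ k, a ≤ k → k < b → p k) :
    ∀ k < b, p k := fun k hk => by
  by_cases hka : k < a
  · exact h1 k hka
  · exact h2 k (not_lt.1 hka) hk

/-- The empty bounded universal statement. [folklore] -/
theorem forall_lt_zero (p : ℕ → Prop) : ∀ k < 0, p k := fun _ hk => absurd hk (Nat.not_lt_zero _)

/-- `List.all` over `List.range` from a bounded universal statement. [folklore] -/
theorem all_range_of_forall {f : ℕ → Bool} {K : ℕ} (h : ∀ k < K, f k = true) : (List.range K).all f = true :=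
  List.all_eq_true.2 fun k hk => h k (List.mem_range.1 hk)

namespace BoxQ

/-- **The all-pairs separation test from its index form.** [folklore] -/
theorem allSepB_of_forall : ∀ (L : List BoxQ),
    (∀ (j k : ℕ) (hj : j < L.length) (hk : k < L.length), j + 2 ≤ k → sepB L[j] L[k] = true) → allSepB L = true
  | [], _ => rfl
  | b :: rest, h => by
    simp only [allSepB, Bool.and_eq_true, List.all_eq_true]
    constructor
    · intro q hq
      obtain ⟨i, hi, rfl⟩ := List.getElem_of_mem hq
      rw [List.getElem_drop]
      have hlen : 1 + i < rest.length := by simp at hi; omega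
      have := h 0 (1 + i + 1) (by simp) (by simp; omega) (by omega)
      simpa using this
    · exact allSepB_of_forall rest fun j k hj hk hjk => by
        have := h (j + 1) (k + 1) (by simp; omega) (by simp; omega) (by omega)
        simpa using this

end BoxQ

namespace PhaseQ

variable {P : PhaseQ}

/-- **The separation test of a phase from its index form.** [folklore] -/
theorem boxSepB_of_forall (h : ∀ j < P.K, ∀ k < P.K, j + 2 ≤ k → BoxQ.sepB (P.node j).box (P.node k).box = true) :
    P.boxSepB = true := by
  apply BoxQ.allSepB_of_forall
  intro j k hj hk hjk
  simp only [List.length_map] at hj hk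
  have := h j hj k hk hjk
  rw [P.node_eq_getElem hj, P.node_eq_getElem hk] at this
  simpa using this

/-- **The validity test of a phase from its index form.** [folklore] -/
theorem elemsValidB_of_forall (hτ : 0 < P.τ) (h : ∀ k < P.K, (P.node k).e.validB = true) : P.elemsValidB = true := by
  simp only [elemsValidB, Bool.and_eq_true, decide_eq_true_eq, List.all_eq_true]
  refine ⟨fun n hn => ?_, hτ⟩
  obtain ⟨k, hk, rfl⟩ := List.getElem_of_mem hn
  have := h k hk
  rwa [P.node_eq_getElem hk] at this

/-- **The positivity test of a phase from its index form.** [folklore] -/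
theorem allPosB_of_forall (h : ∀ k < P.K, (decide (0 < (P.node k).box.ρ) && decide (0 < (P.node k).step.len)) = true) :
    P.allPosB = true := by
  simp only [allPosB, List.all_eq_true]
  intro n hn
  obtain ⟨k, hk, rfl⟩ := List.getElem_of_mem hn
  have := h k hk
  rwa [P.node_eq_getElem hk] at this

/-- **The geometric test of a phase from its index form.** [folklore] -/
theorem geomB_of_forall (hv : P.elemsValidB = true) (hpos : P.allPosB = true)
    (h : ∀ k < P.K, (P.fwdB k && P.bwdB k && P.piecesB k) = true) : P.geomB = true := by
  simp only [geomB, hv, hpos, Bool.true_and]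
  exact all_range_of_forall h

/-- **The junction test of a phase from its index form.** [folklore] -/
theorem agreeB_of_forall
    (h : ∀ j < P.K, (!decide (j + 1 < P.K) ||
      match (P.node j).ann.jkind with
      | .identical => decide ((P.node j).e = (P.node (j + 1)).e)
      | .forms mT mΞ mT' mΞ' za zb za' zb' => ElemQ.agreeJB (P.node j).e (P.node (j + 1)).e mT mΞ mT' mΞ' za zb za' zb') = true) :
    P.agreeB = true :=
  all_range_of_forall h

/-- **The re-description certificate from its index form.** [folklore] -/
theorem redescribeB_of_forall {P' : PhaseQ} {e e' : Bool} {cert cert' : List (Fin 2 × List (ℕ × EquivCert))}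
    (hs : P.sgnsOKB = true) (hs' : P'.sgnsOKB = true) (hm : P.middleInSqB e = true) (hm' : P'.middleInSqB e' = true)
    (hend : endNodesEqB P e P' e' = true) (hl : cert.length = P.K) (hl' : cert'.length = P'.K)
    (hc : ∀ k < P.K, coverEntryB P e P' e' k (cert.getD k (0, [])) = true)
    (hc' : ∀ k' < P'.K, coverEntryB P' e' P e k' (cert'.getD k' (0, [])) = true) :
    redescribeB P e P' e' cert cert' = true := by
  simp only [redescribeB, hs, hs', hm, hm', hend, hl, hl', decide_true, Bool.true_and, Bool.and_eq_true]
  exact ⟨all_range_of_forall hc, all_range_of_forall hc'⟩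

/-- **The similar re-description certificate from its index form.** [folklore] -/
theorem simRedescribeB_of_forall {P' : PhaseQ} {e e' : Bool} {S : Simil} {Q : RectQ}
    {cert cert' : List (Fin 2 × List (ℕ × EquivCert))}
    (hs : P.sgnsOKB = true) (hs' : P'.sgnsOKB = true) (hlam : 0 < S.lam) (hl : cert.length = P.K) (hl' : cert'.length = P'.K)
    (hc : ∀ k < P.K, P.simEntryB e P' e' S Q k (cert.getD k (0, [])) = true)
    (hc' : ∀ k' < P'.K, P'.simEntryB e' P e S.inv (Q.preim S.inv) k' (cert'.getD k' (0, [])) = true) :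
    P.simRedescribeB e P' e' S Q cert cert' = true := by
  simp only [simRedescribeB, hs, hs', hlam, hl, hl', decide_true, Bool.true_and, Bool.and_eq_true]
  exact ⟨all_range_of_forall hc, all_range_of_forall hc'⟩

end PhaseQ

namespace PhaseQ

variable (P : PhaseQ)

/-- **The junction test at one junction** (the summand of `agreeB`). [folklore] -/
def agreeAtB (j : ℕ) : Bool :=
  !decide (j + 1 < P.K) ||
    match (P.node j).ann.jkind with
    | .identical => decide ((P.node j).e = (P.node (j + 1)).e)
    | .forms mT mΞ mT' mΞ' za zb za' zb' => ElemQ.agreeJB (P.node j).e (P.node (j + 1)).e mT mΞ mT' mΞ' za zb za' zb'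

variable {P}

/-- **The junction test of a phase from its junctions.** [folklore] -/
theorem agreeB_of_agreeAtB (h : ∀ j < P.K, P.agreeAtB j = true) : P.agreeB = true :=
  all_range_of_forall h

/-- **The node test of the geometric check** (the summand of `geomB`). [folklore] -/
def geomAtB (P : PhaseQ) (k : ℕ) : Bool := P.fwdB k && P.bwdB k && P.piecesB k

/-- **The geometric test of a phase from its nodes.** [folklore] -/
theorem geomB_of_geomAtB (hv : P.elemsValidB = true) (hpos : P.allPosB = true) (h : ∀ k < P.K, P.geomAtB k = true) :
    P.geomB = true :=
  geomB_of_forall hv hpos h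

/-- **The separation test at one node against all later nodes** (a row of `boxSepB`). [folklore] -/
def sepRowB (P : PhaseQ) (j : ℕ) : Bool :=
  (List.range P.K).all fun k => !decide (j + 2 ≤ k) || BoxQ.sepB (P.node j).box (P.node k).box

/-- **The separation test of a phase from its rows.** [folklore] -/
theorem boxSepB_of_sepRowB (h : ∀ j < P.K, P.sepRowB j = true) : P.boxSepB = true :=
  boxSepB_of_forall fun j hj k hk hjk => by
    have := List.all_eq_true.1 (h j hj) k (List.mem_range.2 hk)
    simpa [hjk] using this

end PhaseQ

/-- **A statement about all cells from its `25` instances** `p = ![i, j]`. [folklore] -/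
theorem forall_cell_of_forall_fin {Φ : (Fin 2 → Fin 5) → Prop} (h : ∀ i j : Fin 5, Φ ![i, j]) : ∀ p, Φ p := fun p => by
  have e : p = ![p 0, p 1] := by
    funext k; fin_cases k <;> rfl
  rw [e]; exact h _ _

end Chunks

/-! ## The final assembly -/

namespace GateC

/-- **Global conditions on the gate template**: valid, squeeze window inside `[0, 1)`, margin at most `1/8`. [folklore] -/
def globalB (C : GateC) : Bool :=
  C.validB && decide (0 ≤ C.t₀) && decide (C.t₀ + 2 * C.τ / 3 < 1) && decide (C.δ ≤ 1 / 8)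

end GateC

/-- The channel profile of radius `r` satisfies the profile facts for `1/100 ≤ r`. [folklore] -/
theorem profileOK_channelProfile {r : ℚ} (hr : 1 / 100 ≤ r) : ProfileOK (channelProfile (r : ℝ)) r := by
  have h100 : (100 : ℝ)⁻¹ ≤ r := by
    have h := (Rat.cast_le (K := ℝ)).2 hr
    push_cast at h
    linarith
  have hr0 : (0 : ℝ) < r := by linarith
  exact
    { smooth := channelProfile_contDiff _
      bound := abs_channelProfile_le_ten h100
      supp := fun q hq => abs_lt_of_channelProfile_ne_zero hr0 hq
      even := channelProfile_neg _ }

/-- **`acm_compatible_blocks` from checked slot lists** (the explicit two generating moves as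
emitted typed-chain data). Given: a gate template datum with its global conditions; a common
profile radius `r ∈ [1/100, 1/2]` (profile `channelProfile r` of
`QuasiSelfSimilarChannelProfile.lean`); a snake table `(childGen, childSym)` (`IsSnakeTable`,
decidable) placing a bent child in the straight channel; for each generator a slot list passing the
slot-list test for the gates of the generator and the end conditions; the uniform start of the
straight channel (slope `1`); and, for every generator `g` and cell `p`, a similar re-description
certificate of the last phase of `g` at clock `1` against the first phase of `childGen g p` at clock
`0` through the child placement `ofChild (childSym g p) p` on the cell — then the glued moves are
the two generating moves of Alberti–Crippa–Mazzucato and `acm_compatible_blocks` holds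
(`acm_compatible_blocks_of_generator_moves`). Every hypothesis is a Boolean test on rational data
or a decidable statement about finite tables. [folklore] -/
theorem acm_compatible_blocks_of_slots (C : GateC) (r : ℚ)
    {childGen : Gen → (Fin 2 → Fin 5) → Gen} {childSym : Gen → (Fin 2 → Fin 5) → SymmCode}
    (hT : IsSnakeTable childGen childSym) (hbent : ∃ p, childGen Gen.S p = Gen.B) (L : Gen → List Slot)
    (scert scert' : Gen → (Fin 2 → Fin 5) → List (Fin 2 × List (ℕ × EquivCert)))
    (hC : C.globalB = true) (hr : 1 / 100 ≤ r ∧ r ≤ 1 / 2)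
    (hL : ∀ g, slotsOKB C (genGate g) r (L g) = true) (hE : ∀ g, endsOKB (L g) = true)
    (hU : (headP (L .S)).uniformB 1 = true)
    (hsim : ∀ (g : Gen) (p : Fin 2 → Fin 5),
      (lastP (L g)).simRedescribeB true (headP (L (childGen g p))) false (Simil.ofChild (childSym g p) p)
        (Simil.cellRect p) (scert g p) (scert' g p) = true) :
    acm_compatible_blocks := by
  set G : ℝ → ℝ := channelProfile (r : ℝ) with hGdef
  have hG : ProfileOK G r := profileOK_channelProfile hr.1
  simp only [GateC.globalB, Bool.and_eq_true, decide_eq_true_eq] at hC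
  obtain ⟨⟨⟨hCv, hC0⟩, hC1⟩, hCδ⟩ := hC
  have hδ : (0 : ℝ) < C.δ := GateC.δ_pos hCv
  have hδ' : (C.δ : ℝ) ≤ 8⁻¹ := by
    have h := (Rat.cast_le (K := ℝ)).2 hCδ
    push_cast at h
    linarith
  have hr0 : (0 : ℝ) < r := by
    have h := (Rat.cast_le (K := ℝ)).2 hr.1
    push_cast at h
    linarith
  have hr2 : (r : ℝ) ≤ 2⁻¹ := by
    have h := (Rat.cast_le (K := ℝ)).2 hr.2
    push_cast at h
    linarith
  -- the two moves
  have hmove : ∀ g, IsGeneratorMove (gluedV (L g)) (gluedΘ G (L g)) (genGate g) C.VgT (C.ΘgT G) C.δ := fun g =>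
    isGeneratorMove_glued hG hCv hC0 hC1 (hL g) (hE g)
  -- the straight block: normalisations from the uniform start
  have hS0 : ∀ z ∈ unitCube (Fin 2), gluedΘ G (L .S) 0 z = channelProfile (r : ℝ) (z 1 - 2⁻¹) := fun z hz => by
    obtain ⟨e0, hclk⟩ := gluedΘ_zero (G := G) (hL .S) (hE .S)
    obtain ⟨hg, hsep, ha, hrS⟩ := head_facts_of_slotsOKB (hL .S)
    rw [e0, PhaseQ.scalar_of_uniformB hG hg hsep ha hrS hU one_pos hclk fun j => ⟨(hz j).1, (hz j).2.le⟩]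
    simp [hGdef]
  obtain ⟨hm0, hm1⟩ := moments_of_channelProfile (Θ := gluedΘ G (L .S)) hr0 hr2 hS0
  have hSb := (hmove .S).toBlock hm0 hm1
  refine acm_compatible_blocks_of_generator_moves (V₀ := fun g => gluedV (L g)) (Θ₀ := fun g => gluedΘ G (L g))
    hδ hδ' hSb (hmove .B) (GateC.isEquivariantGateField_template hG.even) hT hbent fun g p z hz => ?_
  -- the self-similarity clause on the cell `p` of `g`
  obtain ⟨e1, hclk1⟩ := gluedΘ_one (G := G) (hL g) (hE g)
  obtain ⟨e0, hclk0⟩ := gluedΘ_zero (G := G) (hL (childGen g p)) (hE (childGen g p))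
  obtain ⟨hg, hsep, ha, hrg⟩ := okB_last_of_slotsOKB _ (hL g)
  obtain ⟨hg', hsep', ha', hrg'⟩ := head_facts_of_slotsOKB (hL (childGen g p))
  have key := PhaseQ.selfSimilar_cell hG hg hsep ha hrg hg' hsep' ha' hrg' (hsim g p) hclk1 hclk0 hz
  rw [SquareSymm.actScalar_apply] at key ⊢
  show gluedΘ G (L g) 1 z = gluedΘ G (L (childGen g p)) 0 _
  rw [e1, e0]
  exact key

/-- **The same with the shipped snake table** `peanoChildGen / peanoChildSym` of
`QuasiSelfSimilarGenerators.lean`. [folklore] -/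
theorem acm_compatible_blocks_of_slots_peano (C : GateC) (r : ℚ) (L : Gen → List Slot)
    (scert scert' : Gen → (Fin 2 → Fin 5) → List (Fin 2 × List (ℕ × EquivCert)))
    (hC : C.globalB = true) (hr : 1 / 100 ≤ r ∧ r ≤ 1 / 2)
    (hL : ∀ g, slotsOKB C (genGate g) r (L g) = true) (hE : ∀ g, endsOKB (L g) = true)
    (hU : (headP (L .S)).uniformB 1 = true)
    (hsim : ∀ (g : Gen) (p : Fin 2 → Fin 5),
      (lastP (L g)).simRedescribeB true (headP (L (peanoChildGen g p))) false (Simil.ofChild (peanoChildSym g p) p)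
        (Simil.cellRect p) (scert g p) (scert' g p) = true) :
    acm_compatible_blocks :=
  acm_compatible_blocks_of_slots C r isSnakeTable_peano exists_peanoChildGen_straight_eq_bent L scert scert' hC hr hL hE hU hsim

end PlanarKinematics

end Literature.Analysis.FluidPDE
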